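import Summits.CriticalPhenomena.PercolationContinuityZ3.Theorems.PercNearOneGluingNoHeavyLowerTailSunflowerGraphMarkClass
import Summits.CriticalPhenomena.PercolationContinuityZ3.Theorems.PercNearOneGluingNoHeavyLowerTailSunflowerComposition
import Mathlib.Data.Finset.Sum
import Mathlib.Logic.Equiv.Basic
import HarnessLib
import HarnessLib.Audit

/-!
# `NoHeavyLowerTail` (crux stmt-CriticalPhenomena-4575), abstract sunflower cubic: the θ-JOIN (disjoint union) of two sunflowers,
# SAFE FACTORS, and the PRODUCT THEOREM for the partition lemma ★

Support file (seat `prim-ineq-gen-2` gen 27; `--supports stmt-CriticalPhenomena-4575`).  Nothing is asserted about the crux; no `sorry`,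
no named facts.  Memo: run/shared/lean/prim/prim-ineq-gen-2/SAFE-FACTOR-GEN27.md.

SETTING.  `F : Sunflower α`, `G : Sunflower β` (monotone maps `2^α → M₃`, `2^β → M₃`; prove-1 gen 25).  Their θ-JOIN `F.join G` is the sunflower on
`α ⊕ β` with `lab S = lab_F (S ∩ α) ∨ lab_G (S ∩ β)` (`Sunflower.lab_join`; `∨ = joinM` = the join of the diamond `M₃`): the disjoint union of two
coloured hypergraphs / graphs-with-marks (GRAPHMARK-LEAN-GEN26 §7, "formulation for the structural step").

OFFSET FUNCTIONAL.  For a label-offset triple `c = (c₁,c₂,c₃) ∈ M₃³`,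
  `F.zOff c₁ c₂ c₃ = Σ_{ordered 3-partitions (X,Y,Z) of α} s6H (lab X ∨ c₁) (lab Y ∨ c₂) (lab Z ∨ c₃)`
(`zOff 0 0 0 = ZH`).  KEY IDENTITY (`Sunflower.ZH_join_eq`): `(F.join G).ZH = Σ_{(X',Y',Z') ⊢ β} F.zOff (lab_G X') (lab_G Y') (lab_G Z')`.

SAFE FACTORS (`Sunflower.IsSafeWith`).  `F` is SAFE with certificate `(λ, μ)` (`λ ≥ 0`, `μ : M₃ → ℤ≥0`) if, pointwise in `c ∈ M₃³`,
  `λ · s6H c + Σ_x μ x · Rrow x c ≤ F.zOff c`,      `Rrow x (c₁,c₂,c₃) = Σ_p [c_p = x] · kk (c_q, c_r)`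
(`Rrow x` = the symmetrised spectator-Gladkov row; `Σ_{partitions of G} Rrow x (labels) ≥ 0` for EVERY sunflower `G`, `sum_Rrow_nonneg`, three
instances of `spectator_gladkov_nonneg`).

PRODUCT THEOREM (`Sunflower.ZH_join_nonneg_of_isSafeWith`): if `F` is safe and `0 ≤ G.ZH` then `0 ≤ (F.join G).ZH`:
  `(F.join G).ZH = Σ_{π' ⊢ β} F.zOff (labels of π') ≥ Σ_{π'} [λ s6H + Σ_x μ x Rrow x](labels of π') = λ·G.ZH + Σ_x μ x·(spectator Gladkov)_x (G) ≥ 0`.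
So ★ is closed under joining safe factors, and ★ for a disjoint union reduces to ★ of ONE component once the others are certified safe.
CENSUS (memo §2; exact rational LPs): EVERY sunflower on ≤ 4 points is safe (all 1 228 classes), ~6 000 sampled sunflowers on ≤ 7 points, the
costar / K_{2,k} / path / cycle families to 11 points: no unsafe sunflower is known ("SFP conjecture": every sunflower is safe; SFP ⟹ ★ at `c = 0`).
Instances with kernel-checked certificates are in the companion `…SunflowerSafeFactorInstances`.
-/

namespace Summit.CriticalPhenomena.PercolationContinuityZ3.Theorems.SunflowerPartition

open Finset

/-! ## Colour sets of `M₃` labels -/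

/-- The colour set of an `M₃` label: `⊥ ↦ ∅`, petal `i+1 ↦ {i}`, `⊤ ↦ {0,1,2}` (a right inverse of `theta`). [this work] -/
def colset (x : Fin 5) : Finset (Fin 3) := univ.filter fun i : Fin 3 => x = 4 ∨ x.val = i.val + 1

/-- `theta (colset x ∪ colset y)` is the `M₃`-join. [this work] -/
theorem theta_colset_union : ∀ x y : Fin 5, theta (colset x ∪ colset y) = joinM x y := by decide

/-- `colset` is monotone for the diamond order (written as `x = y ∨ x = 0 ∨ y = 4`). [this work] -/
theorem colset_mono : ∀ x y : Fin 5, (x = y ∨ x = 0 ∨ y = 4) → colset x ⊆ colset y := by decide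

/-- `joinM` is commutative. [this work] -/
theorem joinM_comm : ∀ x y : Fin 5, joinM x y = joinM y x := by decide

/-! ## The θ-join of two sunflowers on disjoint ground sets -/

section Join

variable {α β : Type*} [Fintype α] [DecidableEq α] [Fintype β] [DecidableEq β]

/-- The three up-sets of the join: `S ↦ i ∈ colset (lab_F S.toLeft) ∪ colset (lab_G S.toRight)`. [this work] -/
def joinU (F : Sunflower α) (G : Sunflower β) (i : Fin 3) : Finset (Finset (α ⊕ β)) :=
  univ.filter fun S => i ∈ colset (F.lab S.toLeft) ∪ colset (G.lab S.toRight)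

/-- The up-sets of the join are up-sets. [this work] -/
theorem joinU_upper (F : Sunflower α) (G : Sunflower β) (i : Fin 3) :
    IsUpperSet (joinU F G i : Set (Finset (α ⊕ β))) := by
  intro S T hST hS
  rw [Finset.mem_coe, joinU, mem_filter] at hS ⊢
  refine ⟨mem_univ _, ?_⟩
  have h1 := colset_mono _ _ (F.lab_mono (toLeft_subset_toLeft hST))
  have h2 := colset_mono _ _ (G.lab_mono (toRight_subset_toRight hST))
  rw [mem_union] at hS ⊢
  rcases hS.2 with h | h
  · exact Or.inl (h1 h)
  · exact Or.inr (h2 h)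

/-- **The θ-join** `F.join G` of two sunflowers on disjoint ground sets: the sunflower on `α ⊕ β` labelling `S` by
`lab_F (S ∩ α) ∨ lab_G (S ∩ β)` (disjoint union of coloured hypergraphs). [this work] -/
def Sunflower.join (F : Sunflower α) (G : Sunflower β) : Sunflower (α ⊕ β) :=
  ofUpsets (joinU F G) (joinU_upper F G)

/-- **Labels of the join**: `(F.join G).lab S = lab_F S.toLeft ∨ lab_G S.toRight`. [this work] -/
theorem Sunflower.lab_join (F : Sunflower α) (G : Sunflower β) (S : Finset (α ⊕ β)) :
    (F.join G).lab S = joinM (F.lab S.toLeft) (G.lab S.toRight) := by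
  rw [Sunflower.join, lab_ofUpsets_eq_theta, ← theta_colset_union]
  congr 1
  ext i
  simp [joinU]

end Join

/-! ## Partition sums in block-index form; the offset functional and the spectator rows -/

section Fib

variable {α : Type*} [Fintype α] [DecidableEq α]

/-- A nested partition sum on the full cube is a sum over block-index functions. [this work] -/
theorem nested_univ_eq_sum_fib (Φ : Finset α → Finset α → Finset α → ℤ) :
    nested (univ : Finset α) Φ = ∑ g : α → Fin 3, Φ (fib g 0) (fib g 1) (fib g 2) := by
  rw [nested_eq_sum_filter, ← sum_parts_eq_sum_fib]
  have hs : ((univ : Finset α).powerset ×ˢ (univ : Finset α).powerset).filter (fun q => Disjoint q.1 q.2) = parts α := by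
    unfold parts; rw [powerset_univ, univ_product_univ]
  rw [hs]
  refine sum_congr rfl fun q _ => ?_
  rw [← compl_eq_univ_sdiff]

/-- `ZH` as a sum over block-index functions. [this work] -/
theorem Sunflower.ZH_eq_sum_fib (F : Sunflower α) :
    F.ZH = ∑ g : α → Fin 3, s6H (F.lab (fib g 0)) (F.lab (fib g 1)) (F.lab (fib g 2)) := by
  rw [F.ZH_eq_Zp, F.Zp_eq_sum_fib]

/-- **The offset partition functional** `z_F(c) = Σ_{(X,Y,Z) ⊢ α} s6H (lab X ∨ c₁) (lab Y ∨ c₂) (lab Z ∨ c₃)` ("join `F` to a component whose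
three blocks carry the labels `c`"). [this work] -/
def Sunflower.zOff (F : Sunflower α) (c₁ c₂ c₃ : Fin 5) : ℤ :=
  ∑ g : α → Fin 3, s6H (joinM (F.lab (fib g 0)) c₁) (joinM (F.lab (fib g 1)) c₂) (joinM (F.lab (fib g 2)) c₃)

/-- `zOff 0 0 0 = ZH`. [this work] -/
theorem Sunflower.zOff_zero (F : Sunflower α) : F.zOff 0 0 0 = F.ZH := by
  rw [F.ZH_eq_sum_fib]; unfold Sunflower.zOff; simp only [joinM_zero_right]

/-- The symmetrised SPECTATOR-GLADKOV ROW of the label `x`: `Σ_p [c_p = x] · kk (c_q, c_r)`. [this work] -/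
def Rrow (x c₁ c₂ c₃ : Fin 5) : ℤ :=
  (if c₁ = x then kk c₂ c₃ else 0) + (if c₂ = x then kk c₁ c₃ else 0) + (if c₃ = x then kk c₁ c₂ else 0)

/-- One spectator position: `0 ≤ Σ_g [lab (block 0) = x] · kk (lab (block 1)) (lab (block 2))`. [this work] -/
theorem Sunflower.sum_spectator_fib_nonneg (F : Sunflower α) (x : Fin 5) :
    0 ≤ ∑ g : α → Fin 3, (if F.lab (fib g 0) = x then kk (F.lab (fib g 1)) (F.lab (fib g 2)) else 0) := by
  have h := F.spectator_gladkov_nonneg univ (fun y => if y = x then 1 else 0) (fun y => by split_ifs <;> norm_num)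
  rw [nested_univ_eq_sum_fib] at h
  refine le_of_le_of_eq h (sum_congr rfl fun g _ => ?_)
  split_ifs <;> simp

/-- Relabelling the blocks by a permutation of `Fin 3` does not change a sum over block-index functions. [this work] -/
theorem sum_fib_perm (σ : Equiv.Perm (Fin 3)) (Φ : Finset α → Finset α → Finset α → ℤ) :
    ∑ g : α → Fin 3, Φ (fib g 0) (fib g 1) (fib g 2)
      = ∑ g : α → Fin 3, Φ (fib g (σ.symm 0)) (fib g (σ.symm 1)) (fib g (σ.symm 2)) := by
  refine Fintype.sum_equiv ((Equiv.refl α).arrowCongr σ.symm) _ _ fun g => ?_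
  have hg : ((Equiv.refl α).arrowCongr σ.symm) g = σ.symm ∘ g := by
    funext a; simp [Equiv.arrowCongr]
  rw [hg, fib_perm_comp, fib_perm_comp, fib_perm_comp]
  simp

/-- The swap `0 ↔ 1` of `Fin 3`. [this work] -/
def sw01 : Equiv.Perm (Fin 3) := Equiv.swap 0 1
/-- The swap `0 ↔ 2` of `Fin 3`. [this work] -/
def sw02 : Equiv.Perm (Fin 3) := Equiv.swap 0 2

/-- **Spectator Gladkov, symmetrised row**: `0 ≤ Σ_{partitions} Rrow x (labels)` for every sunflower and every spectator label `x`. [this work] -/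
theorem Sunflower.sum_Rrow_nonneg (F : Sunflower α) (x : Fin 5) :
    0 ≤ ∑ g : α → Fin 3, Rrow x (F.lab (fib g 0)) (F.lab (fib g 1)) (F.lab (fib g 2)) := by
  unfold Rrow
  rw [sum_add_distrib, sum_add_distrib]
  have h0 := F.sum_spectator_fib_nonneg x
  have h1 : 0 ≤ ∑ g : α → Fin 3, (if F.lab (fib g 1) = x then kk (F.lab (fib g 0)) (F.lab (fib g 2)) else 0) := by
    rw [sum_fib_perm sw01 (fun X Y Z => if F.lab Y = x then kk (F.lab X) (F.lab Z) else 0)]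
    have e0 : sw01.symm 0 = 1 := by decide
    have e1 : sw01.symm 1 = 0 := by decide
    have e2 : sw01.symm 2 = 2 := by decide
    rw [e0, e1, e2]
    refine le_of_le_of_eq h0 (sum_congr rfl fun g _ => ?_)
    rw [kk_comm]
  have h2 : 0 ≤ ∑ g : α → Fin 3, (if F.lab (fib g 2) = x then kk (F.lab (fib g 0)) (F.lab (fib g 1)) else 0) := by
    rw [sum_fib_perm sw02 (fun X Y Z => if F.lab Z = x then kk (F.lab X) (F.lab Y) else 0)]
    have e0 : sw02.symm 0 = 2 := by decide
    have e1 : sw02.symm 1 = 1 := by decide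
    have e2 : sw02.symm 2 = 0 := by decide
    rw [e0, e1, e2]
    refine le_of_le_of_eq h0 (sum_congr rfl fun g _ => ?_)
    rw [kk_comm]
  linarith

end Fib

/-! ## Safe factors and the product theorem -/

section Product

variable {α β : Type*} [Fintype α] [DecidableEq α] [Fintype β] [DecidableEq β]

/-- **Safe factor with certificate `(lam, mu)`**: `lam ≥ 0`, `mu ≥ 0`, and pointwise in the offset triple `c ∈ M₃³`,
`lam · s6H c + Σ_x mu x · Rrow x c ≤ F.zOff c`. [this work] -/
def Sunflower.IsSafeWith (F : Sunflower α) (lam : ℤ) (mu : Fin 5 → ℤ) : Prop :=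
  0 ≤ lam ∧ (∀ x, 0 ≤ mu x) ∧
    ∀ c₁ c₂ c₃ : Fin 5, lam * s6H c₁ c₂ c₃ + ∑ x : Fin 5, mu x * Rrow x c₁ c₂ c₃ ≤ F.zOff c₁ c₂ c₃

omit [DecidableEq α] [DecidableEq β] in
/-- The blocks of a block-index function on `α ⊕ β` restrict to the blocks of its two components. [this work] -/
theorem fib_sum_toLeft (g₁ : α → Fin 3) (g₂ : β → Fin 3) (k : Fin 3) :
    (fib (Sum.elim g₁ g₂) k).toLeft = fib g₁ k := by
  ext a; simp
omit [DecidableEq α] [DecidableEq β] in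
/-- The blocks of a block-index function on `α ⊕ β` restrict to the blocks of its two components. [this work] -/
theorem fib_sum_toRight (g₁ : α → Fin 3) (g₂ : β → Fin 3) (k : Fin 3) :
    (fib (Sum.elim g₁ g₂) k).toRight = fib g₂ k := by
  ext b; simp

/-- **The join identity**: `(F.join G).ZH = Σ_{partitions π' of β} F.zOff (labels of π')`. [this work] -/
theorem Sunflower.ZH_join_eq (F : Sunflower α) (G : Sunflower β) :
    (F.join G).ZH = ∑ g₂ : β → Fin 3, F.zOff (G.lab (fib g₂ 0)) (G.lab (fib g₂ 1)) (G.lab (fib g₂ 2)) := by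
  rw [(F.join G).ZH_eq_sum_fib]
  rw [← Equiv.sum_comp (Equiv.sumArrowEquivProdArrow α β (Fin 3)).symm]
  rw [Fintype.sum_prod_type_right]
  refine sum_congr rfl fun g₂ _ => ?_
  unfold Sunflower.zOff
  refine sum_congr rfl fun g₁ _ => ?_
  have hg : (Equiv.sumArrowEquivProdArrow α β (Fin 3)).symm (g₁, g₂) = Sum.elim g₁ g₂ := by
    funext s; cases s <;> simp [Equiv.sumArrowEquivProdArrow]
  rw [hg, F.lab_join, F.lab_join, F.lab_join, fib_sum_toLeft, fib_sum_toLeft, fib_sum_toLeft,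
    fib_sum_toRight, fib_sum_toRight, fib_sum_toRight]

/-- **PRODUCT THEOREM** (this work): a safe factor joined to any sunflower satisfying ★ satisfies ★.
`(F.join G).ZH = Σ_{π'} F.zOff (labels π') ≥ λ·G.ZH + Σ_x μ x · (spectator Gladkov)_x(G) ≥ 0`. -/
theorem Sunflower.ZH_join_nonneg_of_isSafeWith (F : Sunflower α) (G : Sunflower β) {lam : ℤ} {mu : Fin 5 → ℤ}
    (hF : F.IsSafeWith lam mu) (hG : 0 ≤ G.ZH) : 0 ≤ (F.join G).ZH := by
  obtain ⟨hlam, hmu, hc⟩ := hF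
  rw [F.ZH_join_eq G]
  have hle : ∑ g₂ : β → Fin 3, (lam * s6H (G.lab (fib g₂ 0)) (G.lab (fib g₂ 1)) (G.lab (fib g₂ 2))
        + ∑ x : Fin 5, mu x * Rrow x (G.lab (fib g₂ 0)) (G.lab (fib g₂ 1)) (G.lab (fib g₂ 2)))
      ≤ ∑ g₂ : β → Fin 3, F.zOff (G.lab (fib g₂ 0)) (G.lab (fib g₂ 1)) (G.lab (fib g₂ 2)) :=
    sum_le_sum fun g₂ _ => hc _ _ _
  refine le_trans ?_ hle
  rw [sum_add_distrib, ← mul_sum, ← G.ZH_eq_sum_fib, sum_comm]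
  refine add_nonneg (mul_nonneg hlam hG) (sum_nonneg fun x _ => ?_)
  rw [← mul_sum]
  exact mul_nonneg (hmu x) (G.sum_Rrow_nonneg x)

/-- **Product theorem, symmetric form**: both `F.join G` and `G.join F` satisfy ★ when `F` is safe and `0 ≤ G.ZH`
(the second by the same identity read from the other side: `(G.join F).ZH = (F.join G).ZH`). [this work] -/
theorem Sunflower.ZH_join_comm (F : Sunflower α) (G : Sunflower β) : (G.join F).ZH = (F.join G).ZH := by
  rw [(G.join F).ZH_eq_sum_fib, (F.join G).ZH_eq_sum_fib]
  rw [← Equiv.sum_comp ((Equiv.sumComm α β).arrowCongr (Equiv.refl (Fin 3)))]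
  refine sum_congr rfl fun g _ => ?_
  have hl : ∀ k, (fib (((Equiv.sumComm α β).arrowCongr (Equiv.refl (Fin 3))) g) k).toLeft = (fib g k).toRight := by
    intro k; ext b; simp [Equiv.arrowCongr]
  have hr : ∀ k, (fib (((Equiv.sumComm α β).arrowCongr (Equiv.refl (Fin 3))) g) k).toRight = (fib g k).toLeft := by
    intro k; ext a; simp [Equiv.arrowCongr]
  rw [G.lab_join, G.lab_join, G.lab_join, F.lab_join, F.lab_join, F.lab_join, hl, hl, hl, hr, hr, hr,
    joinM_comm (G.lab _), joinM_comm (G.lab _), joinM_comm (G.lab _)]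

end Product

end Summit.CriticalPhenomena.PercolationContinuityZ3.Theorems.SunflowerPartition
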